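import Summits.BirchSwinnertonDyer.BirchSwinnertonDyer.Theorems.GenusKolyvaginAtTwoGenusDeepSupplyAtTwoNegDiscNarrowDepthZeroInstance
import Literature.NumberTheory.EllipticCurves.SelmerCorankProofs
import HarnessLib

/-!
# Route `GenusKolyvaginAtTwo`, cruxes 23491 / 25504, registered stub C‴ at depth zero:
# the reduction criterion against RATIONAL torsion — «`y_K` does not reduce into `red(E(ℚ)_tors)` ⟹ `M₀ = 0`»

Seat `bsd-line-gk2-p5` g33 (cell `bsd-f1-sign2`, WIDTH-5 attach), `--supports stmt-BirchSwinnertonDyer-23491 --as helper`.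
THEOREMS ONLY (no definition, no named fact, no `sorry`).  **BSD is NOT proved by this file and no item is closed by it.**

The criterion `DepthZero.depth_eq_zero_of_geomReduction_ne` (p762289) compares `red_ℓ(e_* y_K)` with the reductions of the `Aut(K/ℚ)`-FIXED torsion points
of `E(K)`.  By Galois descent these are exactly the images of the rational torsion points: `Γ_ℚ` acts on `e_* s` through `Aut(K/ℚ)`
(`smul_map_absEmbedding_eq_of_forall_smul_eq`, from `DepthZero.smul_eq_map_absEmbedding_smul` and `absEmbedding_absGaloisQuot_apply`), so `e_* s` is
`Γ_ℚ`-fixed and comes from `E(ℚ)` (`WeierstrassCurve.exists_toGeomPoints_eq_of_forall_smul_eq`).  Hence the memo's form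
(`DEPTH-ZERO-REDUCTION-CRITERION-g21.md` §2 Claim A): **`red_ℓ(e_* y_K) ∉ red_ℓ(E(ℚ)_tors)` ⟹ `M₀ = 0`** (`depth_eq_zero_of_geomReduction_notMem_rationalTorsion`),
and for curves with `E(ℚ)_tors = 0`: **`red_ℓ(e_* y_K) ≠ Õ ⟹ M₀ = 0`** (`depth_eq_zero_of_geomReduction_ne_zero`) — the one-bit reading
«`y_K ≢ Õ (mod 𝔓 ∣ ℓ)`» of instrument I1.  Sign-free.
References: [GrossLMS1991] §5 Prop. 5.3, §4 (4.1); [McCallumLMS1991] §5 Lemma 5.1; [SilvermanAEC2009] VIII.§1 (Galois descent).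
-/

set_option autoImplicit false
set_option linter.dupNamespace false -- `Summit.<P>.<Sub>` repeats `BirchSwinnertonDyer` (D-0017)

noncomputable section

open scoped Classical NumberField Pointwise

namespace Summit.BirchSwinnertonDyer.BirchSwinnertonDyer.Theorems.GenusSupplyNarrow.DepthZero

open IsDedekindDomain Field NumberField WeierstrassCurve Literature.NumberTheory.EllipticCurves
  Literature.NumberTheory.EllipticCurves.ModularForms Literature.NumberTheory.GaloisRepresentations Rat.HeightOneSpectrum

variable {K : Type} [Field K] [NumberField K]

-- NOTE. `E(ℚ) = W.toAffine.Point`: Mathlib's group law on points depends on a `DecidableEq` instance on the base field, and the tree's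
-- generic `WeierstrassCurve.toGeomPoints W : E(F) →+ E(F̄)` (`SelmerCorankProofs`, `open scoped Classical`) carries the classical one, which for
-- `F = ℚ` is not the computable `DecidableEq ℚ` found here.  To stay instance-robust, torsion of a rational point `s₀` is READ IN `E(ℚ̄)`
-- (`IsOfFinAddOrder (ι_* s₀)`, equivalent since `ι_*` is an injective homomorphism), and no group operation on `E(ℚ)` itself is used.

/-! ## §1 `Aut(K/ℚ)`-fixed points of `E(K)` map to `Γ_ℚ`-fixed points of `E(ℚ̄)`, hence come from `E(ℚ)` -/

/-- **`Γ_ℚ` acts on `e_*(E(K))` through `Aut(K/ℚ)`**: for `K/ℚ` normal and `s ∈ E(K)` fixed by every `σ ∈ Aut(K/ℚ)`, `g • e_* s = e_* s` for every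
`g ∈ Γ_ℚ` (`g` acts on `e(K)` as `absGaloisQuot ℚ K g`, `absEmbedding_absGaloisQuot_apply`; then `DepthZero.smul_eq_map_absEmbedding_smul`).
[cite: SilvermanAEC2009, VIII.§1] -/
theorem smul_map_absEmbedding_eq_of_forall_smul_eq (W : WeierstrassCurve ℚ) [Normal ℚ K] {s : (W.baseChange K).toAffine.Point}
    (hs : ∀ σ : K ≃ₐ[ℚ] K, σ • s = s) (g : absoluteGaloisGroup ℚ) :
    g • (show W.geomPoints from Affine.Point.map (W' := W) (absEmbedding ℚ K) s) =
      Affine.Point.map (W' := W) (absEmbedding ℚ K) s := by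
  have hγ : ∀ x : K, g • absEmbedding ℚ K x = absEmbedding ℚ K (absGaloisQuot ℚ K g x) :=
    fun x ↦ (absEmbedding_absGaloisQuot_apply ℚ K g x).symm
  rw [smul_eq_map_absEmbedding_smul W hγ s _ rfl, hs]

/-- **An `Aut(K/ℚ)`-fixed point of `E(K)` is rational in `E(ℚ̄)`**: `e_* s = ι_* s₀` for some `s₀ ∈ E(ℚ)` (`ι_* = WeierstrassCurve.toGeomPoints W : E(ℚ) → E(ℚ̄)`),
by Galois descent over the perfect field `ℚ` (`WeierstrassCurve.exists_toGeomPoints_eq_of_forall_smul_eq`). [cite: SilvermanAEC2009, VIII.§1 (proof of Prop. 1.2)] -/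
theorem exists_toGeomPoints_eq_map_absEmbedding (W : WeierstrassCurve ℚ) [Normal ℚ K] {s : (W.baseChange K).toAffine.Point}
    (hs : ∀ σ : K ≃ₐ[ℚ] K, σ • s = s) :
    ∃ s₀ : W.toAffine.Point, WeierstrassCurve.toGeomPoints W s₀ = Affine.Point.map (W' := W) (absEmbedding ℚ K) s :=
  WeierstrassCurve.exists_toGeomPoints_eq_of_forall_smul_eq W
    (Q := show W.geomPoints from Affine.Point.map (W' := W) (absEmbedding ℚ K) s)
    (smul_map_absEmbedding_eq_of_forall_smul_eq W hs)

/-! ## §2 The criterion against rational torsion -/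

/-- **`M₀ = 0` UNLESS `y_K` REDUCES INTO `red(E(ℚ)_tors)`.**  Hypotheses of `depth_eq_zero_of_geomReduction_ne` (`r_an(E) = 0`, `ρ̄_{E,2}` onto, `d_K·Δ ∉ ℚ²`,
`K` Heegner, `d₁` with `P₀ ↦ P(1)`, good `ℓ ∣ d_K`), with the reduction hypothesis read against the RATIONAL torsion points only:
`red_ℓ(e_* P₀) ≠ red_ℓ(ι_* s₀)` for every `s₀ ∈ E(ℚ)` with `ι_* s₀` torsion (i.e. `s₀ ∈ E(ℚ)_tors`, `ι_*` being an injective homomorphism; read in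
`E(ℚ̄)` for instance-robustness, see the NOTE above) ⟹ `M₀ = 0` (§1: the `Aut(K/ℚ)`-fixed torsion of `E(K)` is `ι_*(E(ℚ)_tors)`).
[cite: GrossLMS1991, §5 Prop. 5.3, §4 (4.1)] [cite: McCallumLMS1991, §5 Lemma 5.1] [cite: SilvermanAEC2009, VIII.§1] -/
theorem depth_eq_zero_of_geomReduction_notMem_rationalTorsion (W : WeierstrassCurve ℚ) [W.IsElliptic] [W.IsGloballyMinimal]
    [NeZero (W.conductorNorm ℤ)] (hK : IsImaginaryQuadratic K) (hH : SatisfiesHeegnerHypothesis (W.conductorNorm ℤ) K)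
    (hr0 : W.analyticRank = 0) (hρ : W.HasSurjectiveModNGaloisRep 2) (hsq : ¬ IsSquare ((NumberField.discr K : ℚ) * W.Δ))
    {ℓ : ℕ} [Fact ℓ.Prime] (hℓ : (ℓ : ℤ) ∣ NumberField.discr K) (hΔ : ¬ (ℓ : ℤ) ∣ minimalDiscriminantInt W)
    (Dt : ModularParametrizationData W (W.conductorNorm ℤ)) (β : ℤ) (ι : K →+* ℂ) (d₁ : KolyvaginHeegnerData Dt β ι 1)
    {P₀ : (W.baseChange K).toAffine.Point}
    (hP₀ : Affine.Point.map (W' := W) (algebraMap K (ringClassField K ι 1)).toRatAlgHom P₀ = d₁.derivedPoint)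
    (hred : ∀ s₀ : W.toAffine.Point, IsOfFinAddOrder (WeierstrassCurve.toGeomPoints W s₀) →
      geomReduction hΔ (Affine.Point.map (W' := W) (absEmbedding ℚ K) P₀ : W.geomPoints) ≠
        geomReduction hΔ (WeierstrassCurve.toGeomPoints W s₀))
    {M₀ : ℕ} (hdiv : ∃ Q : (W.baseChange (ringClassField K ι 1)).toAffine.Point, ((2 ^ M₀ : ℕ) : ℤ) • Q = d₁.derivedPoint) :
    M₀ = 0 := by
  haveI : Algebra.IsQuadraticExtension ℚ K := ⟨hK.1⟩
  haveI : IsGalois ℚ K := inferInstance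
  refine depth_eq_zero_of_geomReduction_ne W hK hH hr0 hρ hsq hℓ hΔ Dt β ι d₁ hP₀ (fun s hsfin hsfix ↦ ?_) hdiv
  obtain ⟨s₀, hs₀⟩ := exists_toGeomPoints_eq_map_absEmbedding W hsfix
  obtain ⟨e, he⟩ : ∃ e : (W.baseChange K).toAffine.Point →+ W.geomPoints,
      e = Affine.Point.map (W' := W) (absEmbedding ℚ K) := ⟨_, rfl⟩
  have hfin : IsOfFinAddOrder (WeierstrassCurve.toGeomPoints W s₀) := by
    have h1 : IsOfFinAddOrder (e s) := e.isOfFinAddOrder hsfin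
    rw [he] at h1
    rw [hs₀]
    exact h1
  have h := hred s₀ hfin
  rw [hs₀] at h
  exact h

/-- **`E(ℚ)_tors = 0`: ONE BIT — `red_ℓ(e_* y_K) ≠ Õ ⟹ M₀ = 0`.**  For curves without rational torsion (hypothesis `htors`, read in `E(ℚ̄)`: every `s₀ ∈ E(ℚ)`
with `ι_* s₀` of finite order has `ι_* s₀ = 0`; the generic habitat curve: `ρ̄_{E,2}` onto kills `E(ℚ)[2]`, odd rational torsion is rare) the criterion is the single bit «`y_K ≢ Õ (mod 𝔓)` at a prime `𝔓` over a good ramified `ℓ ∣ d_K`»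
(instrument I1 of the memo: for the prime Heegner fields of the supply, `ℓ = |d_K|`).  [cite: GrossLMS1991, §5 Prop. 5.3, §4 (4.1)]
[cite: McCallumLMS1991, §5 Lemma 5.1] -/
theorem depth_eq_zero_of_geomReduction_ne_zero (W : WeierstrassCurve ℚ) [W.IsElliptic] [W.IsGloballyMinimal]
    [NeZero (W.conductorNorm ℤ)] (hK : IsImaginaryQuadratic K) (hH : SatisfiesHeegnerHypothesis (W.conductorNorm ℤ) K)
    (hr0 : W.analyticRank = 0) (hρ : W.HasSurjectiveModNGaloisRep 2) (hsq : ¬ IsSquare ((NumberField.discr K : ℚ) * W.Δ))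
    (htors : ∀ s₀ : W.toAffine.Point, IsOfFinAddOrder (WeierstrassCurve.toGeomPoints W s₀) → WeierstrassCurve.toGeomPoints W s₀ = 0)
    {ℓ : ℕ} [Fact ℓ.Prime] (hℓ : (ℓ : ℤ) ∣ NumberField.discr K) (hΔ : ¬ (ℓ : ℤ) ∣ minimalDiscriminantInt W)
    (Dt : ModularParametrizationData W (W.conductorNorm ℤ)) (β : ℤ) (ι : K →+* ℂ) (d₁ : KolyvaginHeegnerData Dt β ι 1)
    {P₀ : (W.baseChange K).toAffine.Point}
    (hP₀ : Affine.Point.map (W' := W) (algebraMap K (ringClassField K ι 1)).toRatAlgHom P₀ = d₁.derivedPoint)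
    (hred : geomReduction hΔ (Affine.Point.map (W' := W) (absEmbedding ℚ K) P₀ : W.geomPoints) ≠ 0)
    {M₀ : ℕ} (hdiv : ∃ Q : (W.baseChange (ringClassField K ι 1)).toAffine.Point, ((2 ^ M₀ : ℕ) : ℤ) • Q = d₁.derivedPoint) :
    M₀ = 0 := by
  refine depth_eq_zero_of_geomReduction_notMem_rationalTorsion W hK hH hr0 hρ hsq hℓ hΔ Dt β ι d₁ hP₀ (fun s₀ hs₀ ↦ ?_) hdiv
  rw [htors s₀ hs₀, map_zero]
  exact hred

end Summit.BirchSwinnertonDyer.BirchSwinnertonDyer.Theorems.GenusSupplyNarrow.DepthZero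

end
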